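import Mathlib.Analysis.SpecialFunctions.Log.Deriv
import Mathlib.Analysis.SpecialFunctions.Pow.Deriv
import Mathlib.Analysis.SpecialFunctions.Pow.Continuity
import Literature.Geometry.Riemannian.RicciFlowMetricLimit
import Literature.Geometry.Lorentzian.MetricNormSqBounds
import HarnessLib

/-!
# Scaled metric equivalence and the continuous limit of `g(t)/(T − t)` (Hamilton 1982, Lemma 14.2)
(helper file 1 for stub `stub_smoothRoundLimit`, line `margerin-cone-hamilton-rails`, crux
`EntropyRung.ChangGurskyYang`, item stmt-SmoothPoincare4-10834)

Along a Ricci flow of Riemannian metrics `g(t)` on `[0, T)` on a manifold with `4`-dimensional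
model, suppose that on `[t₀, T)` the scalar curvature and the traceless Ricci tensor satisfy the
roundness rates `|(T−t)R − 2| ≤ C (T−t)^δ` and `(T−t)² (|Ric|² − R²/4) ≤ C (T−t)^{2δ}` (`δ > 0`).
Then (Hamilton 1982, §14, Lemma 14.2 and §17, Thm. 17.6, in the unnormalised clothes of Hamilton
1986, §5): the tensor `g − 2(T−t)Ric` has `|g − 2(T−t)Ric|²_g = ((T−t)R − 2)² + 4(T−t)²|E|²`
(`normSq_toBilinForm_sub_smul`, an orthonormal-frame computation), hence
`|∂ₜ (g(X,X)/(T−t))| ≤ κ (T−t)^{δ−1} · g(X,X)/(T−t)` with `κ = (C² + 4C)^{1/2}`, an INTEGRABLE rate: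
the scaled metrics `g̃(t) = g(t)/(T−t)` are uniformly equivalent on `[t₀, T)`
(`scaledMetric_equivalence`) and converge, at every point and on every pair of vectors, to a
symmetric positive definite bilinear form (file `…Aux2`, by the logarithmic
Grönwall lemma `logGronwall` / `helper_logGronwall` of this file and polarisation), with the two-sided rate
`e^{−(κ/δ)(T−t)^δ} g̃_t(X,X) ≤ g'(X,X) ≤ e^{(κ/δ)(T−t)^δ} g̃_t(X,X)`.

## References

* R. S. Hamilton, *Three-manifolds with positive Ricci curvature*, J. Differential Geom. 17
  (1982) 255–306, §14, Lemma 14.2; §17, Thm. 17.6. [Hamilton1982]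
* R. S. Hamilton, *Four-manifolds with positive curvature operator*, J. Differential Geom. 24
  (1986) 153–179, §5. [Hamilton1986]
* P. Topping, *Lectures on the Ricci flow*, LMS Lecture Note Series 325, CUP 2006, Lemma 5.3.2
  and §5.3, p. 47. [Topping2006]
-/

noncomputable section

-- every `Summit.SmoothPoincare4.SmoothPoincare4.…` name repeats the summit = sub-problem segment (D-0017 layout)
set_option linter.dupNamespace false

open Set Function Filter Real Module
open scoped Manifold ContDiff Topology

namespace Summit.SmoothPoincare4.SmoothPoincare4.Theorems.MargerinRails

open Literature.Geometry.Riemannian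
open Literature.Geometry.Lorentzian Literature.Geometry.Lorentzian.PseudoRiemannianMetric

/-! ### The logarithmic Grönwall lemma with an integrable rate -/

section Gronwall

/-- **Logarithmic Grönwall with the integrable rate `κ (T−t)^{δ−1}`.** Let `φ > 0` on `[t₀, T)`
have derivative `φ'` within `[t₀, T)` with `|(T−t) φ'(t) + φ(t)| ≤ κ (T−t)^δ φ(t)` (`δ > 0`),
i.e. `ψ = φ/(T−t)` satisfies `|ψ'| ≤ κ (T−t)^{δ−1} ψ`. Then `log ψ ± (κ/δ)(T−t)^δ` are monotone,
so for `t ≤ t'` in `[t₀, T)`,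
`e^{−(κ/δ)((T−t)^δ−(T−t')^δ)} ψ(t) ≤ ψ(t') ≤ e^{(κ/δ)((T−t)^δ−(T−t')^δ)} ψ(t)`, and `ψ` has a
positive limit `ℓ` as `t ↑ T` with `e^{−(κ/δ)(T−t)^δ} ψ(t) ≤ ℓ ≤ e^{(κ/δ)(T−t)^δ} ψ(t)`
(Hamilton 1982, Lemma 14.2: "if `∫ |∂ₜ g| dt < ∞` the metrics are uniformly equivalent and
converge uniformly"). [cite: Hamilton1982, §14, Lemma 14.2] -/
theorem logGronwall {φ φ' : ℝ → ℝ} {t₀ T κ δ : ℝ} (hδ : 0 < δ) (ht₀ : t₀ < T)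
    (hφ : ∀ t ∈ Ico t₀ T, HasDerivWithinAt φ (φ' t) (Ico t₀ T) t)
    (hpos : ∀ t ∈ Ico t₀ T, 0 < φ t)
    (hbd : ∀ t ∈ Ico t₀ T, |(T - t) * φ' t + φ t| ≤ κ * (T - t) ^ δ * φ t) :
    (∀ t ∈ Ico t₀ T, ∀ t' ∈ Ico t T,
      exp (-(κ / δ * ((T - t) ^ δ - (T - t') ^ δ))) * (φ t / (T - t)) ≤ φ t' / (T - t') ∧
      φ t' / (T - t') ≤ exp (κ / δ * ((T - t) ^ δ - (T - t') ^ δ)) * (φ t / (T - t))) ∧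
    ∃ ℓ : ℝ, 0 < ℓ ∧ Tendsto (fun t ↦ φ t / (T - t)) (𝓝[<] T) (𝓝 ℓ) ∧
      ∀ t ∈ Ico t₀ T, exp (-(κ / δ * (T - t) ^ δ)) * (φ t / (T - t)) ≤ ℓ ∧
        ℓ ≤ exp (κ / δ * (T - t) ^ δ) * (φ t / (T - t)) := by
  -- `κ ≥ 0` (test the bound at `t₀`)
  have hκ : 0 ≤ κ := by
    have h0 := hbd t₀ ⟨le_rfl, ht₀⟩
    have h1 : 0 ≤ κ * (T - t₀) ^ δ * φ t₀ := (abs_nonneg _).trans h0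
    have h2 : 0 < (T - t₀) ^ δ * φ t₀ := mul_pos (rpow_pos_of_pos (sub_pos.2 ht₀) δ) (hpos t₀ ⟨le_rfl, ht₀⟩)
    rw [mul_assoc] at h1
    exact nonneg_of_mul_nonneg_left h1 h2
  -- the functions
  set ψ : ℝ → ℝ := fun t ↦ φ t / (T - t) with hψ
  set F : ℝ → ℝ := fun t ↦ log (ψ t) with hF
  set h : ℝ → ℝ := fun t ↦ κ / δ * (T - t) ^ δ with hh
  have hψpos : ∀ t ∈ Ico t₀ T, 0 < ψ t := fun t ht ↦ div_pos (hpos t ht) (sub_pos.2 ht.2)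
  -- derivative of `ψ` and of `F`
  have hψder : ∀ t ∈ Ico t₀ T,
      HasDerivWithinAt ψ (((T - t) * φ' t + φ t) / (T - t) ^ 2) (Ico t₀ T) t := by
    intro t ht
    have hTt : T - t ≠ 0 := (sub_pos.2 ht.2).ne'
    have h1 : HasDerivWithinAt (fun s ↦ T - s) (-1) (Ico t₀ T) t := by
      simpa using (hasDerivWithinAt_id t (Ico t₀ T)).const_sub T
    have h2 := (hφ t ht).div h1 hTt
    refine h2.congr_deriv ?_
    field_simp
    ring
  have hFder : ∀ t ∈ Ico t₀ T,
      HasDerivWithinAt F (((T - t) * φ' t + φ t) / ((T - t) * φ t)) (Ico t₀ T) t := by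
    intro t ht
    have hTt : T - t ≠ 0 := (sub_pos.2 ht.2).ne'
    have hφt : φ t ≠ 0 := (hpos t ht).ne'
    have h2 := (hψder t ht).log (hψpos t ht).ne'
    refine h2.congr_deriv ?_
    simp only [hψ]
    field_simp
  have hFbd : ∀ t ∈ Ico t₀ T, |((T - t) * φ' t + φ t) / ((T - t) * φ t)| ≤ κ * (T - t) ^ (δ - 1) := by
    intro t ht
    have hTt : 0 < T - t := sub_pos.2 ht.2
    have hφt : 0 < φ t := hpos t ht
    rw [abs_div, abs_of_pos (mul_pos hTt hφt), div_le_iff₀ (mul_pos hTt hφt)]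
    calc |(T - t) * φ' t + φ t| ≤ κ * (T - t) ^ δ * φ t := hbd t ht
      _ = κ * (T - t) ^ (δ - 1) * ((T - t) * φ t) := by
          rw [show (T - t) ^ δ = (T - t) ^ (δ - 1) * (T - t) by
            rw [← rpow_add_one hTt.ne', sub_add_cancel]]
          ring
  -- derivative of `h`
  have hhder : ∀ t ∈ Ico t₀ T, HasDerivWithinAt h (-(κ * (T - t) ^ (δ - 1))) (Ico t₀ T) t := by
    intro t ht
    have hTt : T - t ≠ 0 := (sub_pos.2 ht.2).ne'
    have h1 : HasDerivWithinAt (fun s ↦ T - s) (-1) (Ico t₀ T) t := by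
      simpa using (hasDerivWithinAt_id t (Ico t₀ T)).const_sub T
    have h2 := (h1.rpow_const (p := δ) (Or.inl hTt)).const_mul (κ / δ)
    refine h2.congr_deriv ?_
    field_simp
  -- `F + h` is antitone, `F - h` is monotone on `[t₀, T)`
  have hcontF : ContinuousOn F (Ico t₀ T) := fun t ht ↦ (hFder t ht).continuousWithinAt
  have hconth : ContinuousOn h (Ico t₀ T) := fun t ht ↦ (hhder t ht).continuousWithinAt
  have hint : interior (Ico t₀ T) = Ioo t₀ T := interior_Ico
  have hanti : AntitoneOn (fun t ↦ F t + h t) (Ico t₀ T) := by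
    refine antitoneOn_of_hasDerivWithinAt_nonpos (convex_Ico t₀ T) (hcontF.add hconth)
      (f' := fun t ↦ ((T - t) * φ' t + φ t) / ((T - t) * φ t) + -(κ * (T - t) ^ (δ - 1))) ?_ ?_
    · intro t ht
      rw [hint] at ht ⊢
      exact ((hFder t (Ioo_subset_Ico_self ht)).add (hhder t (Ioo_subset_Ico_self ht))).mono
        Ioo_subset_Ico_self
    · intro t ht
      rw [hint] at ht
      have := hFbd t (Ioo_subset_Ico_self ht)
      linarith [le_abs_self (((T - t) * φ' t + φ t) / ((T - t) * φ t))]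
  have hmono : MonotoneOn (fun t ↦ F t - h t) (Ico t₀ T) := by
    refine monotoneOn_of_hasDerivWithinAt_nonneg (convex_Ico t₀ T) (hcontF.sub hconth)
      (f' := fun t ↦ ((T - t) * φ' t + φ t) / ((T - t) * φ t) - -(κ * (T - t) ^ (δ - 1))) ?_ ?_
    · intro t ht
      rw [hint] at ht ⊢
      exact ((hFder t (Ioo_subset_Ico_self ht)).sub (hhder t (Ioo_subset_Ico_self ht))).mono
        Ioo_subset_Ico_self
    · intro t ht
      rw [hint] at ht
      have := hFbd t (Ioo_subset_Ico_self ht)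
      linarith [neg_abs_le (((T - t) * φ' t + φ t) / ((T - t) * φ t))]
  -- two-sided comparison of `F`
  have hFcomp : ∀ t ∈ Ico t₀ T, ∀ t' ∈ Ico t T, |F t' - F t| ≤ h t - h t' := by
    intro t ht t' ht'
    have ht'' : t' ∈ Ico t₀ T := ⟨ht.1.trans ht'.1, ht'.2⟩
    have h1 := hanti ht ht'' ht'.1
    have h2 := hmono ht ht'' ht'.1
    simp only at h1 h2
    rw [abs_le]
    constructor <;> linarith
  have hψexp : ∀ t ∈ Ico t₀ T, ψ t = exp (F t) := fun t ht ↦ by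
    rw [hF, exp_log (hψpos t ht)]
  -- part (i)
  have part1 : ∀ t ∈ Ico t₀ T, ∀ t' ∈ Ico t T,
      exp (-(κ / δ * ((T - t) ^ δ - (T - t') ^ δ))) * ψ t ≤ ψ t' ∧
      ψ t' ≤ exp (κ / δ * ((T - t) ^ δ - (T - t') ^ δ)) * ψ t := by
    intro t ht t' ht'
    have ht'' : t' ∈ Ico t₀ T := ⟨ht.1.trans ht'.1, ht'.2⟩
    have hc := hFcomp t ht t' ht'
    have hdiff : h t - h t' = κ / δ * ((T - t) ^ δ - (T - t') ^ δ) := by simp only [hh]; ring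
    rw [hdiff, abs_le] at hc
    rw [hψexp t ht, hψexp t' ht'', ← exp_add, ← exp_add]
    constructor <;> apply exp_le_exp.2 <;> linarith
  refine ⟨part1, ?_⟩
  -- part (ii): the limit of `F - h`, of `h`, of `F`, of `ψ`
  have hT2 : (t₀ + T) / 2 ∈ Ioo t₀ T := by constructor <;> linarith
  have hbdd : BddAbove ((fun t ↦ F t - h t) '' Ioo t₀ T) := by
    refine ⟨F t₀ + h t₀, ?_⟩
    rintro _ ⟨t, ht, rfl⟩
    have hc := hFcomp t₀ ⟨le_rfl, ht₀⟩ t ⟨ht.1.le, ht.2⟩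
    rw [abs_le] at hc
    have hht : 0 ≤ h t := by
      simp only [hh]
      exact mul_nonneg (div_nonneg hκ hδ.le) (rpow_nonneg (sub_pos.2 ht.2).le δ)
    simp only
    linarith [hc.2]
  have hlim1 : Tendsto (fun t ↦ F t - h t) (𝓝[<] T)
      (𝓝 (sSup ((fun t ↦ F t - h t) '' Ioo t₀ T))) :=
    (hmono.mono Ioo_subset_Ico_self).tendsto_nhdsWithin_Ioo_left ⟨_, hT2⟩ hbdd
  have hlimh : Tendsto h (𝓝[<] T) (𝓝 0) := by
    have hc : ContinuousAt (fun t : ℝ ↦ κ / δ * (T - t) ^ δ) T :=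
      (ContinuousAt.rpow_const (f := fun t : ℝ ↦ T - t) (continuousAt_const.sub continuousAt_id)
        (Or.inr hδ.le)).const_mul _
    have h0 : h T = 0 := by simp [hh, sub_self, zero_rpow hδ.ne']
    rw [← h0]
    exact hc.tendsto.mono_left nhdsWithin_le_nhds
  set L : ℝ := sSup ((fun t ↦ F t - h t) '' Ioo t₀ T) with hL
  have hlimF : Tendsto F (𝓝[<] T) (𝓝 L) := by
    have := hlim1.add hlimh
    simpa using this
  have hlimψ : Tendsto ψ (𝓝[<] T) (𝓝 (exp L)) := by
    have h1 := (continuous_exp.tendsto L).comp hlimF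
    refine h1.congr' ?_
    filter_upwards [Ioo_mem_nhdsLT ht₀] with t ht
    exact (hψexp t (Ioo_subset_Ico_self ht)).symm
  refine ⟨exp L, exp_pos L, hlimψ, fun t ht ↦ ⟨?_, ?_⟩⟩
  · -- lower bound: pass to the limit `t' → T` in part (i)
    have hev : ∀ᶠ t' in 𝓝[<] T, t' ∈ Ico t T := Ico_mem_nhdsLT ht.2
    have hlimlow : Tendsto (fun t' ↦ exp (-(κ / δ * ((T - t) ^ δ - (T - t') ^ δ))) * ψ t)
        (𝓝[<] T) (𝓝 (exp (-(κ / δ * ((T - t) ^ δ - 0))) * ψ t)) := by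
      have hc : Tendsto (fun t' : ℝ ↦ (T - t') ^ δ) (𝓝[<] T) (𝓝 0) := by
        have hc' : ContinuousAt (fun t' : ℝ ↦ (T - t') ^ δ) T :=
          ContinuousAt.rpow_const (f := fun t' : ℝ ↦ T - t') (continuousAt_const.sub continuousAt_id)
            (Or.inr hδ.le)
        have h0 : (fun t' : ℝ ↦ (T - t') ^ δ) T = 0 := by simp [zero_rpow hδ.ne']
        rw [← h0]
        exact hc'.tendsto.mono_left nhdsWithin_le_nhds
      exact ((continuous_exp.tendsto _).comp
        ((tendsto_const_nhds.sub hc).const_mul (κ / δ)).neg).mul_const _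
    rw [sub_zero] at hlimlow
    exact le_of_tendsto_of_tendsto hlimlow hlimψ (hev.mono fun t' ht' ↦ (part1 t ht t' ht').1)
  · have hev : ∀ᶠ t' in 𝓝[<] T, t' ∈ Ico t T := Ico_mem_nhdsLT ht.2
    have hlimup : Tendsto (fun t' ↦ exp (κ / δ * ((T - t) ^ δ - (T - t') ^ δ)) * ψ t)
        (𝓝[<] T) (𝓝 (exp (κ / δ * ((T - t) ^ δ - 0)) * ψ t)) := by
      have hc : Tendsto (fun t' : ℝ ↦ (T - t') ^ δ) (𝓝[<] T) (𝓝 0) := by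
        have hc' : ContinuousAt (fun t' : ℝ ↦ (T - t') ^ δ) T :=
          ContinuousAt.rpow_const (f := fun t' : ℝ ↦ T - t') (continuousAt_const.sub continuousAt_id)
            (Or.inr hδ.le)
        have h0 : (fun t' : ℝ ↦ (T - t') ^ δ) T = 0 := by simp [zero_rpow hδ.ne']
        rw [← h0]
        exact hc'.tendsto.mono_left nhdsWithin_le_nhds
      exact ((continuous_exp.tendsto _).comp
        ((tendsto_const_nhds.sub hc).const_mul (κ / δ))).mul_const _
    rw [sub_zero] at hlimup
    exact le_of_tendsto_of_tendsto hlimψ hlimup (hev.mono fun t' ht' ↦ (part1 t ht t' ht').2)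

/-- **HELPER `helper_logGronwall`** — the registered form of `logGronwall` (logarithmic Grönwall
with the integrable rate `κ (T−t)^{δ−1}`: two-sided control and a positive limit of `φ/(T−t)`
as `t ↑ T`; Hamilton 1982, Lemma 14.2). [cite: Hamilton1982, §14, Lemma 14.2] -/
theorem helper_logGronwall : ∀ {φ φ' : ℝ → ℝ} {t₀ T κ δ : ℝ}, 0 < δ → t₀ < T → (∀ t ∈ Set.Ico t₀ T, HasDerivWithinAt φ (φ' t) (Set.Ico t₀ T) t) → (∀ t ∈ Set.Ico t₀ T, 0 < φ t) → (∀ t ∈ Set.Ico t₀ T, |(T - t) * φ' t + φ t| ≤ κ * (T - t) ^ δ * φ t) → (∀ t ∈ Set.Ico t₀ T, ∀ t' ∈ Set.Ico t T, Real.exp (-(κ / δ * ((T - t) ^ δ - (T - t') ^ δ))) * (φ t / (T - t)) ≤ φ t' / (T - t') ∧ φ t' / (T - t') ≤ Real.exp (κ / δ * ((T - t) ^ δ - (T - t') ^ δ)) * (φ t / (T - t))) ∧ ∃ ℓ : ℝ, 0 < ℓ ∧ Filter.Tendsto (fun t ↦ φ t / (T - t)) (nhdsWithin T (Set.Iio T))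 (nhds ℓ) ∧ ∀ t ∈ Set.Ico t₀ T, Real.exp (-(κ / δ * (T - t) ^ δ)) * (φ t / (T - t)) ≤ ℓ ∧ ℓ ≤ Real.exp (κ / δ * (T - t) ^ δ) * (φ t / (T - t)) := by
  intro φ φ' t₀ T κ δ hδ ht₀ hφ hpos hbd
  exact logGronwall hδ ht₀ hφ hpos hbd

end Gronwall

/-! ### The velocity of the scaled metric: `|g − 2(T−t)Ric|²_g = ((T−t)R − 2)² + 4(T−t)²|E|²` -/

section Algebra

variable {E : Type*} [NormedAddCommGroup E] [NormedSpace ℝ E] [FiniteDimensional ℝ E]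
  {H : Type*} [TopologicalSpace H] {I : ModelWithCorners ℝ E H}
  {M : Type*} [TopologicalSpace M] [ChartedSpace H M] [IsManifold I ∞ M] {n : ℕ∞ω}
  (g : PseudoRiemannianMetric I n E (TangentSpace I : M → Type _))

/-- **`|g − cT|²_g = m − 2c tr_g T + c² |T|²_g`** for a Riemannian metric on an `m`-dimensional
model and a bilinear form `T` (expand in a `g_x`-orthonormal basis: `normSq_eq_sum_sq`,
`trace_eq_sum_of_isOrthonormalFrame`). [cite: ONeill1983, Ch. 3, pp. 60–61] -/
theorem normSq_toBilinForm_sub_smul (hg : g.IsRiemannian) {m : ℕ} (hE : finrank ℝ E = m) (x : M)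
    (T : LinearMap.BilinForm ℝ (TangentSpace I x)) (c : ℝ) :
    g.normSq x (g.toBilinForm x - c • T) = m - 2 * c * g.trace x T + c ^ 2 * g.normSq x T := by
  classical
  obtain ⟨b, hb⟩ := g.exists_basis_isOrthonormalFrame (x := x) (fun v hv ↦ hg x v hv) hE
  have hO : (g.toBilinForm x).IsOrthoᵢ b := fun i j hij ↦ hb.2 i j hij
  have hc : ∀ i, g.val x (b i) (b i) ≠ 0 := fun i ↦ by rw [hb.1 i]; exact one_ne_zero
  have hval : ∀ i j, g.val x (b j) (b i) = if j = i then 1 else 0 := fun i j ↦ by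
    by_cases h : j = i
    · subst h; simp [hb.1 j]
    · simp [h, hb.2 j i h]
  rw [g.normSq_eq_sum_sq x b hO hc, g.normSq_eq_sum_sq x b hO hc,
    g.trace_eq_sum_of_isOrthonormalFrame b hb T]
  simp only [hb.1, mul_one, div_one, LinearMap.sub_apply, LinearMap.smul_apply, smul_eq_mul,
    toBilinForm_apply, hval]
  have h1 : ∀ i, ∑ j, ((if j = i then (1 : ℝ) else 0) - c * T (b j) (b i)) ^ 2 =
      1 - 2 * c * T (b i) (b i) + c ^ 2 * ∑ j, T (b j) (b i) ^ 2 := by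
    intro i
    have h2 : ∀ j, ((if j = i then (1 : ℝ) else 0) - c * T (b j) (b i)) ^ 2 =
        (if j = i then (1 : ℝ) else 0) - 2 * c * (if j = i then T (b j) (b i) else 0) +
          c ^ 2 * T (b j) (b i) ^ 2 := by
      intro j; split_ifs <;> ring
    simp only [h2, Finset.sum_add_distrib, Finset.sum_sub_distrib, Finset.sum_ite_eq',
      Finset.mem_univ, if_true, ← Finset.mul_sum]
  simp only [h1, Finset.sum_add_distrib, Finset.sum_sub_distrib, ← Finset.mul_sum,
    Finset.sum_const, Finset.card_univ, Fintype.card_fin, nsmul_eq_mul, mul_one]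

/-- **The pointwise velocity bound of the scaled metric** (Hamilton 1982, §17, Thm. 17.6 in
unnormalised form): on a `4`-dimensional model, if `|s tr T − 2| ≤ a₁` and
`s² (|T|² − (tr T)²/4) ≤ a₂` then `|g − 2sT|²_g = (s tr T − 2)² + 4 s² (|T|² − (tr T)²/4) ≤ a₁² + 4a₂`
and hence `|g(X,X) − 2s T(X,X)| ≤ (a₁² + 4a₂)^{1/2} g(X,X)` (Cauchy–Schwarz,
`abs_apply_le_sqrt_normSq_mul`). [cite: Hamilton1982, §17, Thm. 17.6] -/
theorem abs_sub_two_mul_apply_le (hg : g.IsRiemannian) (hE : finrank ℝ E = 4) (x : M)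
    (T : LinearMap.BilinForm ℝ (TangentSpace I x)) {s a₁ a₂ : ℝ}
    (h₁ : |s * g.trace x T - 2| ≤ a₁) (h₂ : s ^ 2 * (g.normSq x T - g.trace x T ^ 2 / 4) ≤ a₂)
    (X : TangentSpace I x) :
    |g.val x X X - 2 * s * T X X| ≤ Real.sqrt (a₁ ^ 2 + 4 * a₂) * g.val x X X := by
  have hid := normSq_toBilinForm_sub_smul g hg hE x T (2 * s)
  have hle : g.normSq x (g.toBilinForm x - (2 * s) • T) ≤ a₁ ^ 2 + 4 * a₂ := by
    rw [hid]
    have ha₁ : (s * g.trace x T - 2) ^ 2 ≤ a₁ ^ 2 := by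
      have h0 : 0 ≤ a₁ := (abs_nonneg _).trans h₁
      nlinarith [abs_nonneg (s * g.trace x T - 2), sq_abs (s * g.trace x T - 2)]
    push_cast
    nlinarith
  have hcs := g.abs_apply_le_sqrt_normSq_mul x hg (g.toBilinForm x - (2 * s) • T) X
  have happ : (g.toBilinForm x - (2 * s) • T) X X = g.val x X X - 2 * s * T X X := by
    simp [smul_eq_mul]
  rw [happ] at hcs
  have hg0 : 0 ≤ g.val x X X := by
    by_cases hX : X = 0
    · subst hX; simp
    · exact (hg x X hX).le
  exact hcs.trans (mul_le_mul_of_nonneg_right (Real.sqrt_le_sqrt hle) hg0)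

end Algebra

end Summit.SmoothPoincare4.SmoothPoincare4.Theorems.MargerinRails

end
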